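import Mathlib
import Summits.ValiantsHypothesis.ValiantsHypothesis.Theses.FeketeSOS
import Summits.ValiantsHypothesis.ValiantsHypothesis.Theorems.FeketeSOSSublinearShadowFewSquaresReduction
import Summits.ValiantsHypothesis.ValiantsHypothesis.Theorems.FeketeSOSSublinearShadowWindowOfSupportShadow

/-!
# `FeketeSOS.SublinearShadow` (stmt-ValiantsHypothesis-14990), line `Sketch` — REDUCTION TO THE FEW-SQUARES SUPPORT SHADOW

`sublinearShadow_of_supportShadowFew`: the crux `SublinearShadow` follows from the SUPPORT SHADOW in the only regime the
line leaves open: every complex representation `Σ_{i<s} c_i g_i² = F_p` with `deg g_i ≤ p²`, support-sum `S`, `S⁴ ≤ p³`,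
`3 ≤ s`, FEW squares (`(s+1)^B · S < 2p`) and PARETO-MINIMAL cost has supports carrying an EXACT characteristic-`p`
representation of `F̄_p` with `≤ (s+1)^B` weighted squares per support class (the hypothesis, stated inline — it is the
open core of the crux, not a published fact; registered stub `stub_supportShadowFew` of the line's skeleton).
Proof: base change to an algebraic closure; the bridge `stub_windowOfSupportShadow` (3-AP-free `Π`-exponents) turns the
exact representation with `m ≤ (s+1)^B` squares per class into a window model of order `v`, `2v + 2 ≤ 8(m+1)³ ≤
(s+1)^{3B+3}`; then `sublinearShadow_of_orderBudgetFew` (trivial two-square shadow for many squares, DFT window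
reduction for few).  Net constants: `A = 3B + 4`.
-/

namespace Summit.ValiantsHypothesis.ValiantsHypothesis.Theorems.SublinearShadowSketch

open Polynomial Finset
open scoped BigOperators

-- `Summit.ValiantsHypothesis.ValiantsHypothesis.…` is the tree's mandated single-conjunct layout (Sub = Summit).
set_option linter.dupNamespace false

/-- **Crux ⟸ few-squares Pareto-minimal SUPPORT SHADOW.**  If the supports of every Pareto-minimal sublinear complex
representation of `F_p` with `3 ≤ s` and `(s+1)^B·S < 2p` (`p` large) carry an exact characteristic-`p` representation of
`F̄_p` with `≤ (s+1)^B` squares per support class, then `FeketeSOS.SublinearShadow` holds (with `A = 3B + 4`). -/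
theorem sublinearShadow_of_supportShadowFew : (∃ B p₁ : ℕ, ∀ (p : ℕ) [Fact p.Prime], p₁ ≤ p → ∀ (s : ℕ) (c : Fin s → ℂ) (g : Fin s → Polynomial ℂ), (∀ i, (g i).natDegree ≤ p ^ 2) → (∑ i, (g i).support.card) ^ 4 ≤ p ^ 3 → (∑ i, Polynomial.C (c i) * g i ^ 2) = ∑ m ∈ Finset.range p, Polynomial.C ((legendreSym p m : ℤ) : ℂ) * Polynomial.X ^ m → 3 ≤ s → (s + 1) ^ B * (∑ i, (g i).support.card) < 2 * p → (∀ (s' : ℕ) (c' : Fin s' → ℂ) (g' : Fin s' → Polynomial ℂ), s' ≤ s → (∀ i, (g' i).natDegree ≤ p ^ 2) → (∑ i, Polynomial.C (c' i) * g' i ^ 2) = ∑ m ∈ Finset.range p, Polynomial.C ((legendreSym p m : ℤ) : ℂ) * Polynomial.X ^ m → (∑ i, (g i).support.card) ≤ ∑ i, (g' i).support.card) → ∃ (m : ℕ) (K : Type) (_ : Field K) (_ : CharP K p) (a : Fin s → Fin m → K) (h : Fin s → Fin m → Polynomial K), m ≤ (s + 1) ^ B ∧ (∀ i k, (h i k).support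 ⊆ (g i).support) ∧ (∑ i, ∑ k, Polynomial.C (a i k) * h i k ^ 2) = ∑ m ∈ Finset.range p, Polynomial.C ((legendreSym p m : ℤ) : K) * Polynomial.X ^ m) → Summit.ValiantsHypothesis.ValiantsHypothesis.Theses.FeketeSOS.SublinearShadow := by
  intro hSS
  refine sublinearShadow_of_orderBudgetFew ?_
  show
    ∃ B p₁ : ℕ, ∀ (p : ℕ) [Fact p.Prime], p₁ ≤ p → ∀ (s : ℕ) (c : Fin s → ℂ) (g : Fin s → Polynomial ℂ),
      (∀ i, (g i).natDegree ≤ p ^ 2) → (∑ i, (g i).support.card) ^ 4 ≤ p ^ 3 →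
      (∑ i, Polynomial.C (c i) * g i ^ 2)
        = ∑ m ∈ Finset.range p, Polynomial.C ((legendreSym p m : ℤ) : ℂ) * Polynomial.X ^ m →
      3 ≤ s → (s + 1) ^ B * (∑ i, (g i).support.card) < 2 * p →
      (∀ (s' : ℕ) (c' : Fin s' → ℂ) (g' : Fin s' → Polynomial ℂ), s' ≤ s →
        (∀ i, (g' i).natDegree ≤ p ^ 2) →
        (∑ i, Polynomial.C (c' i) * g' i ^ 2)
          = ∑ m ∈ Finset.range p, Polynomial.C ((legendreSym p m : ℤ) : ℂ) * Polynomial.X ^ m →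
        (∑ i, (g i).support.card) ≤ ∑ i, (g' i).support.card) →
      ∃ (v : ℕ) (K : Type) (_ : Field K) (_ : CharP K p) (_ : IsAlgClosed K)
        (γ : Fin s → Polynomial K) (Y : Fin s → Polynomial (Polynomial K)) (u₀ : K),
        2 * v + 2 ≤ (s + 1) ^ B ∧ u₀ ≠ 0 ∧ (∀ i, (γ i).natDegree ≤ v) ∧ (∀ i, (Y i).natDegree ≤ v) ∧
        (∀ i n, ((Y i).coeff n).support ⊆ (g i).support) ∧
        (∑ i, (γ i).map (Polynomial.C : K →+* Polynomial K) * Y i ^ 2).coeff v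
          = Polynomial.C u₀ * ∑ m ∈ Finset.range p, Polynomial.C ((legendreSym p m : ℤ) : K) * Polynomial.X ^ m
  obtain ⟨B, p₁, H⟩ := hSS
  -- the few-squares hypothesis is MONOTONE in `B`, so we may serve the weaker budget `3B + 3 ≥ B`
  refine ⟨3 * B + 3, p₁, ?_⟩
  intro p _ hp s c g hdeg hS hrep h3 hfew hmin
  classical
  have hs1 : 1 ≤ s + 1 := Nat.succ_pos s
  have hfew' : (s + 1) ^ B * (∑ i, (g i).support.card) < 2 * p :=
    lt_of_le_of_lt (Nat.mul_le_mul_right _ (Nat.pow_le_pow_right hs1 (by omega))) hfew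
  obtain ⟨m, K, instF, instC, a, h, hm, hh, hrepK⟩ := H p hp s c g hdeg hS hrep h3 hfew' hmin
  -- base change to an algebraic closure
  let L := AlgebraicClosure K
  let f : K →+* L := algebraMap K L
  haveI : CharP L p := charP_of_injective_algebraMap (algebraMap K L).injective p
  have hrepL : (∑ i, ∑ k, Polynomial.C (f (a i k)) * ((h i k).map f) ^ 2)
      = ∑ m ∈ Finset.range p, Polynomial.C ((legendreSym p m : ℤ) : L) * Polynomial.X ^ m := by
    have := congrArg (Polynomial.map f) hrepK
    simp only [Polynomial.map_sum, Polynomial.map_mul, Polynomial.map_pow, Polynomial.map_C,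
      Polynomial.map_X, map_intCast f] at this
    exact this
  have hhL : ∀ i k, ((h i k).map f).support ⊆ (g i).support :=
    fun i k => (support_map_subset _ _).trans (hh i k)
  obtain ⟨v, γ, Y, hv, hγ, hY, hsupp, hlayer⟩ :=
    stub_windowOfSupportShadow L s m (fun i => (g i).support) (fun i k => f (a i k))
      (fun i k => (h i k).map f) _ hhL hrepL
  refine ⟨v, L, inferInstance, inferInstance, inferInstance, γ, Y, 1, ?_, one_ne_zero, hγ, hY, hsupp, ?_⟩
  · -- 2v + 2 ≤ 8 (m+1)^3 ≤ 8 (2 (s+1)^B)^3 = 64 (s+1)^{3B} ≤ (s+1)^{3B+3}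
    have h4 : 4 ≤ s + 1 := by omega
    have hm1 : m + 1 ≤ 2 * (s + 1) ^ B := by
      have : 1 ≤ (s + 1) ^ B := Nat.one_le_pow _ _ hs1
      omega
    calc 2 * v + 2 = 2 * (v + 1) := by ring
      _ ≤ 2 * (4 * (m + 1) ^ 3) := Nat.mul_le_mul_left 2 hv
      _ = 8 * (m + 1) ^ 3 := by ring
      _ ≤ 8 * (2 * (s + 1) ^ B) ^ 3 := Nat.mul_le_mul_left 8 (Nat.pow_le_pow_left hm1 3)
      _ = 64 * ((s + 1) ^ B) ^ 3 := by ring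
      _ ≤ (s + 1) ^ 3 * ((s + 1) ^ B) ^ 3 :=
          Nat.mul_le_mul_right _ (le_trans (by norm_num) (Nat.pow_le_pow_left h4 3))
      _ = (s + 1) ^ (3 * B + 3) := by ring
  · rw [hlayer, map_one, one_mul]

end Summit.ValiantsHypothesis.ValiantsHypothesis.Theorems.SublinearShadowSketch
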